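import Summits.QuantumFields.BalabanUV.Beta.WardLocusQuarticWall
import Summits.QuantumFields.BalabanUV.Beta.KernelWardMColumn
import Summits.QuantumFields.BalabanUV.Beta.SecondOrderContactResidual

/-!
# `BalabanUV.Beta.WardLocusQuarticTable` — binder row D1, (L4) W-side of hW, «D1-hW-L4-WARD-ALL» part A: THE TABLE LAWS OF THE NEXT LEVEL's
# SECOND-ORDER FIELD TABLE `T2RecAt (j+1)` (both slots) and of the level-0 table `T2RecAt 0`, IN THE LITERAL `hS₂` / `hS₂''` SHAPE OF
# `KernelWardSymAssembly.divW_W2SymOfK_eq_conjV_add_residuals`, FROM the level-`j` KERNEL law of the carrier `WrecAt j` (induction hypothesis), the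
# BORDER letter of the `vh₂S` sector and the WILSON letter at level 0 (hypothesis-functions), and ONE units lock per level
# (β sub-cell, D1 formalisation swarm, unit `b2b-balaban-beta-d1-formalise-leaf-06`, gen 3; INTENT «D1-hW-L4-WARD-ALL» journal 2026-08-20T12:24Z)

NOT IN PRINT; OUR BOOKKEEPING.  HONEST FRAMING (cell charter, verbatim): «discharging `BetaPertH` makes Bałaban's UV stability UNCONDITIONAL — a real
constructive-QFT result; it is NOT the continuum limit and NOT the Clay problem.»  HONEST DEPENDENCY (verbatim): «continuum YM on T⁴ ⇐ BetaPertH ∧ nine spine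
estimates (0/9 proved); BetaPertH ⇐ (D1) ∧ (D4) ∧ CAP+tail; G-an2-4 gates asym, D1 and NE2/3/4.»  [folklore] kernel algebra over tree objects BY NAME; the
level-`j` kernel law, the border letter (an1's lane), the level-0 Wilson letter (leaf-09 / an3's lane; for `T := wsym22 N` it is leaf-09-g4's
`WilsonBiStencilWardSocket.hS₂_wilson`) and the units lock are DISPLAYED HYPOTHESES; no statement of Bałaban's papers, no `[cite:]`, no `def`, no
`def … : Prop`; instantiates NO binder of the β-function wall.  NOT hW, NOT D1, NOT `BetaPertH`, NOT continuum, NOT Clay.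

WHAT.  The recursive W-literal v2.26 (`SpineRecursiveW`): `WrecAt j = W2SymOfK G_j Lc (SpureRecAt j) (M1At j) (T2RecAt j) (M2Of mixFF j)` over
`G_j = coDressKBmAt ρ Lc (KInvStep Lc j)`, with `T2RecAt (j+1) = (cE₂·wV4 (j+1)) • e4OfKW Lc G_j (SpureRecAt j) (M1At j) (WrecAt j) + (cB·wB2 (j+1)) • vh₂S` and
`SpureRecAt (j+1) = (cE·wE (j+1)) • e3OfK Lc G_j (SrecAt j) + (cVH·wVH (j+1)) • vhSAt ρ` at the pin `(cE, cVH) = (Lc^{d+1}, −Lc^{d+1}·½·Lc^{d+1})`, generator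
`X y = diagK (½ • Σ_{v ∈ box} legInd ρ (Lc•y + v))` (the hW Ward pin of `WardLocusRecursiveEnd`).  The per-level socket of an1's/leaf-10's
`KernelWardSymAssembly` wants, for the pair `(S, S₂) = (SpureRecAt j, T2RecAt j)`, the TABLE laws
`hS₂ : cH • Σ_v divV (fun κ u ↦ S₂ κ u κ′ u′) (Lc•y + v) = comp (S κ′ u′) (X y) − comp (X y) (S κ′ u′) + R y κ′ u′` and its second-slot twin `hS₂''`.
* §1 `sectorLaw_add` / `sectorLaw_add''` — table laws are ADDITIVE over sectors (`divV_add`, `add_comp_diagK`, `diagK_comp_add`): a law for each sector of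
  `S₂` against the matching sector of `S`, same `cH`, same generator ⇒ the law for the sums, remainders added.
* §2 `tableLaw_e4OfKW_sector''` — the SECOND-slot law of the `e4OfKW` sector of a swap-symmetric carrier = leaf-10-g3's first-slot law
  `WardLocusQuartic.tableLaw_e4OfKW_sector` after `e4OfKW_swap`.
* §3 **`tableLaw_T2RecAt_succ` / `tableLaw_T2RecAt_succ''`** — THE WALL INSTANCE AT LEVEL `j+1`, both slots: from the level-`j` kernel law of `WrecAt j`
  (localised residual `𝒩`; every other input of `tableLaw_e4OfKW_sector` a LANDED theorem, as in `WardLocusQuarticWall.divV_e4OfKW_wall`), the border letter of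
  the `vh₂S` sector at level `j+1` (hypothesis-function with remainder `RB`), and the lock `cH′·(cE₂·wV4 (j+1))·½ = (Lc^{d+1}·wE (j+1))·½` ⇒ the `hS₂` / `hS₂''` laws
  of `T2RecAt (j+1)` against `SpureRecAt (j+1)` with the DISPLAYED remainder `−(cH′·cE₂·wV4 (j+1)) • Σ_v mmRead Lc (G_j∘𝒩∘G_j) + RB`.
* §4 `tableLaw_T2RecAt_zero` / `_zero''` — level 0: Wilson letter (sector `cE₂ • wilsonW₂ d T` against `cE • wilsonA`) + border letter ⇒ the laws of `T2RecAt 0`.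
* §5 `lock_succ_of_pin` — with `cH′ := (stepScale (j+1)·Lc^{d+1})⁻¹` (the constant of `KernelWardHColumnWall.colH_ward_KInvStep_all`) the level-(j+1) lock IS
  `cE₂ = Lc^{2(d+1)}` (an2's (W-L-2) / gan24's `hpinEq`), for every `j`.
Provenance: D1 formalisation swarm, leaf prover 06 (gen 3), 2026-08-20; no existing file touched.
-/

noncomputable section

open Finset
open scoped BigOperators
open Literature.MathematicalPhysics.QuantumFieldTheory
open Literature.MathematicalPhysics.QuantumFieldTheory.Balaban1983to89
open Literature.MathematicalPhysics.QuantumFieldTheory.Balaban1983to89.Beta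
open ExpKernelCalculus (MKer Decays BiLoc VertexFamily VertexFamily₂ comp)
open KernelWard (divV divW)
open AffineAveraging (box toSite)
open OneStepResolventKernel (Fib LocStencil)
open OneStepKernelFamily (KInvStep colH vertexOfK)
open BalabanStepJetsSucc (mmRead wE wVH)
open SecondOrderResponse (vertexOfM dM K2OfK LocStencilFM)
open BalabanCompositeJets (LocStencil₂)
open BalabanStepW2 (K3OfK wV4 wB2)
open StepJetData (wilsonA)
open WilsonBiStencil (wilsonW₂)
open AveragingHessianKernelsRooted (vhSAt)
open Summit.QuantumFields.BalabanUV.Beta.TameKernelCalculus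
open Summit.QuantumFields.BalabanUV.Beta.ChartConjugation (conjV)
open Summit.QuantumFields.BalabanUV.Beta.ChartConjugationRelative (RelInv)
open Summit.QuantumFields.BalabanUV.Beta.BorderedHessian (diagK bhKStepAt stepScale spr_bhKStepAt comp_axEc_diagK_comm
  relInv_coDressKBmAt_KInvStep_bhKStepAt)
open Summit.QuantumFields.BalabanUV.Beta.AveragingWardRootedStencils (legInd)
open Summit.QuantumFields.BalabanUV.Beta.AxialDressingRooted (coDressKBmAt axEc spr_axEc decays_coDressKBmAt_KInvStep)
open Summit.QuantumFields.BalabanUV.Beta.SpineRooted (e4OfKW e4OfKW_swap SpureRecAt SpureRecAt_zero_level SpureRecAt_succ M1At e3OfK T2RecAt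
  T2RecAt_zero_level T2RecAt_succ WrecAt WrecAt_swap locStencil_SpureRecAt WrecAt_loc₂ vertexFamily_M1At)
open Summit.QuantumFields.BalabanUV.Beta.WardLocusRecursive (SrecAt)
open Summit.QuantumFields.BalabanUV.Beta.SecondOrderContactMmRead (mmRead_K2OfK_eq_e3OfK)
open Summit.QuantumFields.BalabanUV.Beta.SecondOrderContactForm (add_comp_diagK diagK_comp_add)
open Summit.QuantumFields.BalabanUV.Beta.KernelWardMColumn (divV_add)
open Summit.QuantumFields.BalabanUV.Beta.WardLocusQuartic (tableLaw_e4OfKW_sector)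
open Summit.QuantumFields.BalabanUV.Beta.WardLocusQuarticWall (dM_SpureRecAt_M1At divV_dM_SpureRecAt_M1At_pin)

namespace Summit.QuantumFields.BalabanUV.Beta.WardLocusQuarticTable

/-! ## §1 Table laws are additive over sectors -/

section Sectors

variable {d N' : ℕ}

/-- [folklore] **TABLE LAWS ADD OVER SECTORS, FIRST SLOT.**  If two sectors `S₂A`, `S₂B` of a second-order table satisfy the `hS₂`-shaped law (same
constant `cH`, same DIAGONAL generator `diagK (g Y)`) against first-order partners `SA`, `SB` with remainders `RA`, `RB`, then so does `S₂A + S₂B` against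
`SA + SB` with remainder `RA + RB` (`divV_add`, `add_comp_diagK`, `diagK_comp_add`). -/
theorem sectorLaw_add {S₂A S₂B : Fin (d + 1) → (Fin (d + 1) → ℤ) → Fin (d + 1) → (Fin (d + 1) → ℤ) → MKer (d + 1) (Fib d)}
    {SA SB : Fin (d + 1) → (Fin (d + 1) → ℤ) → MKer (d + 1) (Fib d)} {g : (Fin (d + 1) → ℤ) → (Fin (d + 1) → ℤ) → Fib d → ℝ}
    {RA RB : (Fin (d + 1) → ℤ) → Fin (d + 1) → (Fin (d + 1) → ℤ) → MKer (d + 1) (Fib d)} {cH : ℝ}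
    (hA : ∀ (Y : Fin (d + 1) → ℤ) (κ' : Fin (d + 1)) (u' : Fin (d + 1) → ℤ),
      cH • ∑ v ∈ box (d + 1) N', divV (fun κ u => S₂A κ u κ' u') ((N' : ℤ) • Y + toSite v) =
        comp (SA κ' u') (diagK (g Y)) - comp (diagK (g Y)) (SA κ' u') + RA Y κ' u')
    (hB : ∀ (Y : Fin (d + 1) → ℤ) (κ' : Fin (d + 1)) (u' : Fin (d + 1) → ℤ),
      cH • ∑ v ∈ box (d + 1) N', divV (fun κ u => S₂B κ u κ' u') ((N' : ℤ) • Y + toSite v) =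
        comp (SB κ' u') (diagK (g Y)) - comp (diagK (g Y)) (SB κ' u') + RB Y κ' u')
    (Y : Fin (d + 1) → ℤ) (κ' : Fin (d + 1)) (u' : Fin (d + 1) → ℤ) :
    cH • ∑ v ∈ box (d + 1) N', divV (fun κ u => S₂A κ u κ' u' + S₂B κ u κ' u') ((N' : ℤ) • Y + toSite v) =
      comp (SA κ' u' + SB κ' u') (diagK (g Y)) - comp (diagK (g Y)) (SA κ' u' + SB κ' u') + (RA Y κ' u' + RB Y κ' u') := by
  have h1 : ∀ w : Fin (d + 1) → ℤ, divV (fun κ u => S₂A κ u κ' u' + S₂B κ u κ' u') w =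
      divV (fun κ u => S₂A κ u κ' u') w + divV (fun κ u => S₂B κ u κ' u') w :=
    fun w => divV_add (fun κ u => S₂A κ u κ' u') (fun κ u => S₂B κ u κ' u') w
  simp_rw [h1]
  rw [Finset.sum_add_distrib, smul_add, hA, hB, add_comp_diagK, diagK_comp_add]
  abel

/-- [folklore] **TABLE LAWS ADD OVER SECTORS, SECOND SLOT** (the `hS₂''` shape: divergence in the second bond of `S₂ κ u`). -/
theorem sectorLaw_add'' {S₂A S₂B : Fin (d + 1) → (Fin (d + 1) → ℤ) → Fin (d + 1) → (Fin (d + 1) → ℤ) → MKer (d + 1) (Fib d)}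
    {SA SB : Fin (d + 1) → (Fin (d + 1) → ℤ) → MKer (d + 1) (Fib d)} {g : (Fin (d + 1) → ℤ) → (Fin (d + 1) → ℤ) → Fib d → ℝ}
    {RA RB : (Fin (d + 1) → ℤ) → Fin (d + 1) → (Fin (d + 1) → ℤ) → MKer (d + 1) (Fib d)} {cH : ℝ}
    (hA : ∀ (Y : Fin (d + 1) → ℤ) (κ : Fin (d + 1)) (u : Fin (d + 1) → ℤ),
      cH • ∑ v ∈ box (d + 1) N', divV (S₂A κ u) ((N' : ℤ) • Y + toSite v) =
        comp (SA κ u) (diagK (g Y)) - comp (diagK (g Y)) (SA κ u) + RA Y κ u)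
    (hB : ∀ (Y : Fin (d + 1) → ℤ) (κ : Fin (d + 1)) (u : Fin (d + 1) → ℤ),
      cH • ∑ v ∈ box (d + 1) N', divV (S₂B κ u) ((N' : ℤ) • Y + toSite v) =
        comp (SB κ u) (diagK (g Y)) - comp (diagK (g Y)) (SB κ u) + RB Y κ u)
    (Y : Fin (d + 1) → ℤ) (κ : Fin (d + 1)) (u : Fin (d + 1) → ℤ) :
    cH • ∑ v ∈ box (d + 1) N', divV (fun κ' u' => S₂A κ u κ' u' + S₂B κ u κ' u') ((N' : ℤ) • Y + toSite v) =
      comp (SA κ u + SB κ u) (diagK (g Y)) - comp (diagK (g Y)) (SA κ u + SB κ u) + (RA Y κ u + RB Y κ u) := by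
  have h1 : ∀ w : Fin (d + 1) → ℤ, divV (fun κ' u' => S₂A κ u κ' u' + S₂B κ u κ' u') w = divV (S₂A κ u) w + divV (S₂B κ u) w :=
    fun w => divV_add (S₂A κ u) (S₂B κ u) w
  simp_rw [h1]
  rw [Finset.sum_add_distrib, smul_add, hA, hB, add_comp_diagK, diagK_comp_add]
  abel

end Sectors

/-! ## §2 The second-slot law of the `e4OfKW` sector of a swap-symmetric carrier -/

section SecondSlot

variable {d N : ℕ}

/-- [folklore] **THE (T2-S₂)-SHAPED TABLE LAW OF THE `e4OfKW` SECTOR, SECOND SLOT**: for a swap-symmetric carrier `W`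
(`W ν y′ μ y = W μ y ν y′`, e.g. `WrecAt j` by `WrecAt_swap`) `e4OfKW N K S M W κ u κ′ u′ = e4OfKW N K S M W κ′ u′ κ u` (`e4OfKW_swap`), so the divergence in the
SECOND bond obeys leaf-10-g3's first-slot law `WardLocusQuartic.tableLaw_e4OfKW_sector` verbatim (same remainder, read at `(κ, u)`). -/
theorem tableLaw_e4OfKW_sector'' {K 𝕄 E : MKer (d + 1) (Fib d)} (hK : Spr K) (h𝕄 : Spr 𝕄) (hE : Spr E) (hR : RelInv K 𝕄 E)
    {S M : Fin (d + 1) → (Fin (d + 1) → ℤ) → MKer (d + 1) (Fib d)} (hDl : ∀ μ y, Loc (dM K N S M μ y))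
    {W : Fin (d + 1) → (Fin (d + 1) → ℤ) → Fin (d + 1) → (Fin (d + 1) → ℤ) → MKer (d + 1) (Fib d)} (hWl : ∀ μ y ν y', Loc (W μ y ν y'))
    (hWs : ∀ μ y ν y', W ν y' μ y = W μ y ν y')
    {r : Fin (d + 1) → ℕ} (hr : r ∈ box (d + 1) N) (ξ : ℝ)
    (hX : ∀ y : Fin (d + 1) → ℤ, Loc (diagK (ξ • ∑ v ∈ box (d + 1) N, legInd (toSite r) ((N : ℤ) • y + toSite v))))
    (hEX : ∀ y : Fin (d + 1) → ℤ, comp E (diagK (ξ • ∑ v ∈ box (d + 1) N, legInd (toSite r) ((N : ℤ) • y + toSite v))) =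
      comp (diagK (ξ • ∑ v ∈ box (d + 1) N, legInd (toSite r) ((N : ℤ) • y + toSite v))) E)
    (hD : ∀ y : Fin (d + 1) → ℤ, divV (dM K N S M) y = conjV 𝕄 (diagK (ξ • ∑ v ∈ box (d + 1) N, legInd (toSite r) ((N : ℤ) • y + toSite v))))
    {𝒩 : (Fin (d + 1) → ℤ) → Fin (d + 1) → (Fin (d + 1) → ℤ) → MKer (d + 1) (Fib d)} (h𝒩 : ∀ y ν y', Loc (𝒩 y ν y'))
    (hWd : ∀ (y : Fin (d + 1) → ℤ) (ν : Fin (d + 1)) (y' : Fin (d + 1) → ℤ), divW W y ν y' =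
      conjV (dM K N S M ν y') (diagK (ξ • ∑ v ∈ box (d + 1) N, legInd (toSite r) ((N : ℤ) • y + toSite v))) + 𝒩 y ν y')
    {cH' a₁ a₂ ξ' : ℝ} (hlock : cH' * a₂ * ξ = a₁ * ξ') (N' : ℕ) (ρ' Y : Fin (d + 1) → ℤ) (κ : Fin (d + 1)) (u : Fin (d + 1) → ℤ) :
    cH' • ∑ v ∈ box (d + 1) N', divV (fun κ' u' => a₂ • e4OfKW N K S M W κ u κ' u') ((N' : ℤ) • Y + toSite v) =
      comp (a₁ • mmRead N (K2OfK K N S M κ u)) (diagK (ξ' • ∑ v ∈ box (d + 1) N', legInd ρ' ((N' : ℤ) • Y + toSite v)))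
        - comp (diagK (ξ' • ∑ v ∈ box (d + 1) N', legInd ρ' ((N' : ℤ) • Y + toSite v))) (a₁ • mmRead N (K2OfK K N S M κ u))
        + -(cH' * a₂) • ∑ v ∈ box (d + 1) N', mmRead N (comp (comp K (𝒩 ((N' : ℤ) • Y + toSite v) κ u)) K) := by
  have h : (fun κ' u' => a₂ • e4OfKW N K S M W κ u κ' u') = fun κ' u' => a₂ • e4OfKW N K S M W κ' u' κ u := by
    funext κ' u'
    rw [e4OfKW_swap K S M hWs κ' u' κ u]
  rw [h]
  exact tableLaw_e4OfKW_sector hK h𝕄 hE hR hDl hWl hr ξ hX hEX hD h𝒩 hWd hlock N' ρ' Y κ u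

end SecondSlot

/-! ## §3 The wall instance: the table laws of `T2RecAt (j+1)` against `SpureRecAt (j+1)`, both slots -/

section Wall

variable {d Lc : ℕ} [NeZero Lc]

/-- [folklore] **THE `hS₂` LAW OF THE NEXT LEVEL's FIELD TABLE `T2RecAt (j+1)`, FIRST SLOT** (in-block root `ρ = toSite r`, the hW Ward pin
`(cE, cVH) = (Lc^{d+1}, −Lc^{d+1}·½·Lc^{d+1})`, generator `X Y = diagK (½ • Σ_v legInd ρ (Lc•Y + v))`).  HYPOTHESES (displayed): the level-`j` KERNEL law `hWd` of
`WrecAt j` with a localised residual `𝒩` (the induction hypothesis; its other inputs are tree theorems — `decays_coDressKBmAt_KInvStep`, `spr_bhKStepAt`,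
`spr_axEc`, `relInv_coDressKBmAt_KInvStep_bhKStepAt`, `loc_dM`, `WrecAt_loc₂`, `loc_diagK_smul_sum_legInd`, `comp_axEc_diagK_comm`,
`divV_dM_SpureRecAt_M1At_pin`); the BORDER letter `hBord` of the sector `(cB·wB2 (j+1)) • vh₂S` against `(cVH·wVH (j+1)) • vhSAt ρ` with remainder `RB`
(an1's lane); the units lock `cH′·(cE₂·wV4 (j+1))·½ = (Lc^{d+1}·wE (j+1))·½` (§5: ⟺ `cE₂ = Lc^{2(d+1)}` for the Ward constant of `colH_ward_KInvStep_all`).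
CONCLUSION: the `hS₂` law of `T2RecAt (j+1)` against `SpureRecAt (j+1)` with remainder `−(cH′·(cE₂·wV4 (j+1))) • Σ_v mmRead Lc (G_j∘𝒩 (Lc•Y+v) κ′ u′∘G_j) + RB Y κ′ u′`. -/
theorem tableLaw_T2RecAt_succ (hLc : 1 ≤ Lc) {r : Fin (d + 1) → ℕ} (hr : r ∈ box (d + 1) Lc) (cΛ cE₂ cB : ℝ)
    (T : Fin 4 → Fin 4 → Fin 4 → Fin 4 → ℝ)
    {vh₂S : Fin (d + 1) → (Fin (d + 1) → ℤ) → Fin (d + 1) → (Fin (d + 1) → ℤ) → MKer (d + 1) (Fib d)}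
    (hB : ∃ C δ : ℝ, 0 < δ ∧ LocStencil₂ vh₂S C δ)
    {mixFF : Fin (d + 1) → (Fin (d + 1) → ℤ) → Fin (d + 1) → (Fin (d + 1) → ℤ) → MKer (d + 1) (Fib d)}
    (hmix : ∃ C δ : ℝ, 0 < δ ∧ LocStencilFM Lc mixFF C δ) (j : ℕ)
    {𝒩 : (Fin (d + 1) → ℤ) → Fin (d + 1) → (Fin (d + 1) → ℤ) → MKer (d + 1) (Fib d)} (h𝒩 : ∀ y ν y', Loc (𝒩 y ν y'))
    (hWd : ∀ (y : Fin (d + 1) → ℤ) (ν : Fin (d + 1)) (y' : Fin (d + 1) → ℤ),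
      divW (WrecAt d Lc (toSite r) ((Lc : ℝ) ^ (d + 1)) (-((Lc : ℝ) ^ (d + 1) * (1 / 2) * (Lc : ℝ) ^ (d + 1))) cΛ cE₂ cB T vh₂S mixFF j) y ν y' =
        conjV (dM (coDressKBmAt (toSite r) Lc (KInvStep (d := d) Lc j)) Lc
            (SpureRecAt d Lc (toSite r) ((Lc : ℝ) ^ (d + 1)) (-((Lc : ℝ) ^ (d + 1) * (1 / 2) * (Lc : ℝ) ^ (d + 1))) cΛ j)
            (M1At d Lc (toSite r) cΛ j) ν y')
          (diagK (((1 : ℝ) / 2) • ∑ v ∈ box (d + 1) Lc, legInd (toSite r) ((Lc : ℤ) • y + toSite v))) + 𝒩 y ν y')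
    {cH' : ℝ} (hlock : cH' * (cE₂ * wV4 d Lc (j + 1)) * ((1 : ℝ) / 2) = ((Lc : ℝ) ^ (d + 1) * wE d Lc (j + 1)) * ((1 : ℝ) / 2))
    {RB : (Fin (d + 1) → ℤ) → Fin (d + 1) → (Fin (d + 1) → ℤ) → MKer (d + 1) (Fib d)}
    (hBord : ∀ (Y : Fin (d + 1) → ℤ) (κ' : Fin (d + 1)) (u' : Fin (d + 1) → ℤ),
      cH' • ∑ v ∈ box (d + 1) Lc, divV (fun κ u => (cB * wB2 d Lc (j + 1)) • vh₂S κ u κ' u') ((Lc : ℤ) • Y + toSite v) =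
        comp ((-((Lc : ℝ) ^ (d + 1) * (1 / 2) * (Lc : ℝ) ^ (d + 1)) * wVH d Lc (j + 1)) • vhSAt (toSite r) d Lc rfl κ' u')
            (diagK (((1 : ℝ) / 2) • ∑ v ∈ box (d + 1) Lc, legInd (toSite r) ((Lc : ℤ) • Y + toSite v)))
          - comp (diagK (((1 : ℝ) / 2) • ∑ v ∈ box (d + 1) Lc, legInd (toSite r) ((Lc : ℤ) • Y + toSite v)))
            ((-((Lc : ℝ) ^ (d + 1) * (1 / 2) * (Lc : ℝ) ^ (d + 1)) * wVH d Lc (j + 1)) • vhSAt (toSite r) d Lc rfl κ' u')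
          + RB Y κ' u')
    (Y : Fin (d + 1) → ℤ) (κ' : Fin (d + 1)) (u' : Fin (d + 1) → ℤ) :
    cH' • ∑ v ∈ box (d + 1) Lc, divV (fun κ u =>
        T2RecAt d Lc (toSite r) ((Lc : ℝ) ^ (d + 1)) (-((Lc : ℝ) ^ (d + 1) * (1 / 2) * (Lc : ℝ) ^ (d + 1))) cΛ cE₂ cB T vh₂S mixFF (j + 1) κ u κ' u')
        ((Lc : ℤ) • Y + toSite v) =
      comp (SpureRecAt d Lc (toSite r) ((Lc : ℝ) ^ (d + 1)) (-((Lc : ℝ) ^ (d + 1) * (1 / 2) * (Lc : ℝ) ^ (d + 1))) cΛ (j + 1) κ' u')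
          (diagK (((1 : ℝ) / 2) • ∑ v ∈ box (d + 1) Lc, legInd (toSite r) ((Lc : ℤ) • Y + toSite v)))
        - comp (diagK (((1 : ℝ) / 2) • ∑ v ∈ box (d + 1) Lc, legInd (toSite r) ((Lc : ℤ) • Y + toSite v)))
          (SpureRecAt d Lc (toSite r) ((Lc : ℝ) ^ (d + 1)) (-((Lc : ℝ) ^ (d + 1) * (1 / 2) * (Lc : ℝ) ^ (d + 1))) cΛ (j + 1) κ' u')
        + (-(cH' * (cE₂ * wV4 d Lc (j + 1))) • ∑ v ∈ box (d + 1) Lc,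
              mmRead Lc (comp (comp (coDressKBmAt (toSite r) Lc (KInvStep (d := d) Lc j)) (𝒩 ((Lc : ℤ) • Y + toSite v) κ' u'))
                (coDressKBmAt (toSite r) Lc (KInvStep (d := d) Lc j)))
            + RB Y κ' u') := by
  set cE : ℝ := (Lc : ℝ) ^ (d + 1) with hcE
  set cVH : ℝ := -((Lc : ℝ) ^ (d + 1) * (1 / 2) * (Lc : ℝ) ^ (d + 1)) with hcVH
  obtain ⟨δK, CK, hδK, hCK, hKd⟩ := decays_coDressKBmAt_KInvStep (d := d) hr j
  have hKs : Spr (coDressKBmAt (toSite r) Lc (KInvStep (d := d) Lc j)) := ⟨CK, δK, hδK, hKd⟩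
  obtain ⟨Cs, δs, hδs, hS⟩ := locStencil_SpureRecAt (d := d) hLc hr cE cVH cΛ j
  have hDl : ∀ μ y, Loc (dM (coDressKBmAt (toSite r) Lc (KInvStep (d := d) Lc j)) Lc (SpureRecAt d Lc (toSite r) cE cVH cΛ j)
      (M1At d Lc (toSite r) cΛ j) μ y) := fun μ y =>
    SecondOrderTransport.loc_dM hKd hCK (Cs := |Cs|) (fun κ u => biLoc_of_le (hS κ u) (min_le_left δs δK))
      (vertexFamily_M1At hLc hr cΛ j (le_min hδs.le hδK.le)) (lt_min hδs hδK) (min_le_right δs δK) μ y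
  have hWl : ∀ μ y ν y', Loc (WrecAt d Lc (toSite r) cE cVH cΛ cE₂ cB T vh₂S mixFF j μ y ν y') := fun μ y ν y' =>
    ⟨_, _, _, _, SpineRooted.δwRecOf_pos hLc hr cE cVH cΛ cE₂ cB T hB hmix j, WrecAt_loc₂ hLc hr cE cVH cΛ cE₂ cB T hB hmix j μ y ν y'⟩
  -- the `e4OfKW` sector (leaf-10-g3's table law, the `mm`-read identified with the E-letter of the next first-order table)
  have hA : ∀ (Y : Fin (d + 1) → ℤ) (κ' : Fin (d + 1)) (u' : Fin (d + 1) → ℤ),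
      cH' • ∑ v ∈ box (d + 1) Lc, divV (fun κ u => (cE₂ * wV4 d Lc (j + 1)) •
          e4OfKW Lc (coDressKBmAt (toSite r) Lc (KInvStep (d := d) Lc j)) (SpureRecAt d Lc (toSite r) cE cVH cΛ j) (M1At d Lc (toSite r) cΛ j)
            (WrecAt d Lc (toSite r) cE cVH cΛ cE₂ cB T vh₂S mixFF j) κ u κ' u') ((Lc : ℤ) • Y + toSite v) =
        comp ((cE * wE d Lc (j + 1)) • e3OfK Lc (coDressKBmAt (toSite r) Lc (KInvStep (d := d) Lc j)) (SrecAt d Lc (toSite r) cE cVH cΛ j) κ' u')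
            (diagK (((1 : ℝ) / 2) • ∑ v ∈ box (d + 1) Lc, legInd (toSite r) ((Lc : ℤ) • Y + toSite v)))
          - comp (diagK (((1 : ℝ) / 2) • ∑ v ∈ box (d + 1) Lc, legInd (toSite r) ((Lc : ℤ) • Y + toSite v)))
            ((cE * wE d Lc (j + 1)) • e3OfK Lc (coDressKBmAt (toSite r) Lc (KInvStep (d := d) Lc j)) (SrecAt d Lc (toSite r) cE cVH cΛ j) κ' u')
          + -(cH' * (cE₂ * wV4 d Lc (j + 1))) • ∑ v ∈ box (d + 1) Lc,
              mmRead Lc (comp (comp (coDressKBmAt (toSite r) Lc (KInvStep (d := d) Lc j)) (𝒩 ((Lc : ℤ) • Y + toSite v) κ' u'))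
                (coDressKBmAt (toSite r) Lc (KInvStep (d := d) Lc j))) := by
    intro Y κ' u'
    rw [← mmRead_K2OfK_eq_e3OfK _ κ' u' (dM_SpureRecAt_M1At hr cE cVH cΛ j κ' u')]
    exact tableLaw_e4OfKW_sector hKs (spr_bhKStepAt hr j) (spr_axEc _ _) (relInv_coDressKBmAt_KInvStep_bhKStepAt hr j) hDl hWl hr ((1 : ℝ) / 2)
      (fun y => KernelWardLevels.loc_diagK_smul_sum_legInd Lc (toSite r) _ y) (fun y => comp_axEc_diagK_comm _ _ _)
      (divV_dM_SpureRecAt_M1At_pin hr cΛ j) h𝒩 hWd hlock Lc (toSite r) Y κ' u'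
  have h := sectorLaw_add (N' := Lc) hA hBord Y κ' u'
  simpa only [T2RecAt_succ, SpureRecAt_succ] using h

/-- [folklore] **THE `hS₂''` LAW OF `T2RecAt (j+1)`, SECOND SLOT** — the same with the divergence in the second bond: the `e4OfKW` sector by §2
(`WrecAt_swap`), the border sector by its second-slot letter `hBord''` (remainder `RB''`). -/
theorem tableLaw_T2RecAt_succ'' (hLc : 1 ≤ Lc) {r : Fin (d + 1) → ℕ} (hr : r ∈ box (d + 1) Lc) (cΛ cE₂ cB : ℝ)
    (T : Fin 4 → Fin 4 → Fin 4 → Fin 4 → ℝ)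
    {vh₂S : Fin (d + 1) → (Fin (d + 1) → ℤ) → Fin (d + 1) → (Fin (d + 1) → ℤ) → MKer (d + 1) (Fib d)}
    (hB : ∃ C δ : ℝ, 0 < δ ∧ LocStencil₂ vh₂S C δ)
    {mixFF : Fin (d + 1) → (Fin (d + 1) → ℤ) → Fin (d + 1) → (Fin (d + 1) → ℤ) → MKer (d + 1) (Fib d)}
    (hmix : ∃ C δ : ℝ, 0 < δ ∧ LocStencilFM Lc mixFF C δ) (j : ℕ)
    {𝒩 : (Fin (d + 1) → ℤ) → Fin (d + 1) → (Fin (d + 1) → ℤ) → MKer (d + 1) (Fib d)} (h𝒩 : ∀ y ν y', Loc (𝒩 y ν y'))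
    (hWd : ∀ (y : Fin (d + 1) → ℤ) (ν : Fin (d + 1)) (y' : Fin (d + 1) → ℤ),
      divW (WrecAt d Lc (toSite r) ((Lc : ℝ) ^ (d + 1)) (-((Lc : ℝ) ^ (d + 1) * (1 / 2) * (Lc : ℝ) ^ (d + 1))) cΛ cE₂ cB T vh₂S mixFF j) y ν y' =
        conjV (dM (coDressKBmAt (toSite r) Lc (KInvStep (d := d) Lc j)) Lc
            (SpureRecAt d Lc (toSite r) ((Lc : ℝ) ^ (d + 1)) (-((Lc : ℝ) ^ (d + 1) * (1 / 2) * (Lc : ℝ) ^ (d + 1))) cΛ j)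
            (M1At d Lc (toSite r) cΛ j) ν y')
          (diagK (((1 : ℝ) / 2) • ∑ v ∈ box (d + 1) Lc, legInd (toSite r) ((Lc : ℤ) • y + toSite v))) + 𝒩 y ν y')
    {cH' : ℝ} (hlock : cH' * (cE₂ * wV4 d Lc (j + 1)) * ((1 : ℝ) / 2) = ((Lc : ℝ) ^ (d + 1) * wE d Lc (j + 1)) * ((1 : ℝ) / 2))
    {RB'' : (Fin (d + 1) → ℤ) → Fin (d + 1) → (Fin (d + 1) → ℤ) → MKer (d + 1) (Fib d)}
    (hBord'' : ∀ (Y : Fin (d + 1) → ℤ) (κ : Fin (d + 1)) (u : Fin (d + 1) → ℤ),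
      cH' • ∑ v ∈ box (d + 1) Lc, divV (fun κ' u' => (cB * wB2 d Lc (j + 1)) • vh₂S κ u κ' u') ((Lc : ℤ) • Y + toSite v) =
        comp ((-((Lc : ℝ) ^ (d + 1) * (1 / 2) * (Lc : ℝ) ^ (d + 1)) * wVH d Lc (j + 1)) • vhSAt (toSite r) d Lc rfl κ u)
            (diagK (((1 : ℝ) / 2) • ∑ v ∈ box (d + 1) Lc, legInd (toSite r) ((Lc : ℤ) • Y + toSite v)))
          - comp (diagK (((1 : ℝ) / 2) • ∑ v ∈ box (d + 1) Lc, legInd (toSite r) ((Lc : ℤ) • Y + toSite v)))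
            ((-((Lc : ℝ) ^ (d + 1) * (1 / 2) * (Lc : ℝ) ^ (d + 1)) * wVH d Lc (j + 1)) • vhSAt (toSite r) d Lc rfl κ u)
          + RB'' Y κ u)
    (Y : Fin (d + 1) → ℤ) (κ : Fin (d + 1)) (u : Fin (d + 1) → ℤ) :
    cH' • ∑ v ∈ box (d + 1) Lc, divV
        (T2RecAt d Lc (toSite r) ((Lc : ℝ) ^ (d + 1)) (-((Lc : ℝ) ^ (d + 1) * (1 / 2) * (Lc : ℝ) ^ (d + 1))) cΛ cE₂ cB T vh₂S mixFF (j + 1) κ u)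
        ((Lc : ℤ) • Y + toSite v) =
      comp (SpureRecAt d Lc (toSite r) ((Lc : ℝ) ^ (d + 1)) (-((Lc : ℝ) ^ (d + 1) * (1 / 2) * (Lc : ℝ) ^ (d + 1))) cΛ (j + 1) κ u)
          (diagK (((1 : ℝ) / 2) • ∑ v ∈ box (d + 1) Lc, legInd (toSite r) ((Lc : ℤ) • Y + toSite v)))
        - comp (diagK (((1 : ℝ) / 2) • ∑ v ∈ box (d + 1) Lc, legInd (toSite r) ((Lc : ℤ) • Y + toSite v)))
          (SpureRecAt d Lc (toSite r) ((Lc : ℝ) ^ (d + 1)) (-((Lc : ℝ) ^ (d + 1) * (1 / 2) * (Lc : ℝ) ^ (d + 1))) cΛ (j + 1) κ u)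
        + (-(cH' * (cE₂ * wV4 d Lc (j + 1))) • ∑ v ∈ box (d + 1) Lc,
              mmRead Lc (comp (comp (coDressKBmAt (toSite r) Lc (KInvStep (d := d) Lc j)) (𝒩 ((Lc : ℤ) • Y + toSite v) κ u))
                (coDressKBmAt (toSite r) Lc (KInvStep (d := d) Lc j)))
            + RB'' Y κ u) := by
  set cE : ℝ := (Lc : ℝ) ^ (d + 1) with hcE
  set cVH : ℝ := -((Lc : ℝ) ^ (d + 1) * (1 / 2) * (Lc : ℝ) ^ (d + 1)) with hcVH
  obtain ⟨δK, CK, hδK, hCK, hKd⟩ := decays_coDressKBmAt_KInvStep (d := d) hr j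
  have hKs : Spr (coDressKBmAt (toSite r) Lc (KInvStep (d := d) Lc j)) := ⟨CK, δK, hδK, hKd⟩
  obtain ⟨Cs, δs, hδs, hS⟩ := locStencil_SpureRecAt (d := d) hLc hr cE cVH cΛ j
  have hDl : ∀ μ y, Loc (dM (coDressKBmAt (toSite r) Lc (KInvStep (d := d) Lc j)) Lc (SpureRecAt d Lc (toSite r) cE cVH cΛ j)
      (M1At d Lc (toSite r) cΛ j) μ y) := fun μ y =>
    SecondOrderTransport.loc_dM hKd hCK (Cs := |Cs|) (fun κ u => biLoc_of_le (hS κ u) (min_le_left δs δK))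
      (vertexFamily_M1At hLc hr cΛ j (le_min hδs.le hδK.le)) (lt_min hδs hδK) (min_le_right δs δK) μ y
  have hWl : ∀ μ y ν y', Loc (WrecAt d Lc (toSite r) cE cVH cΛ cE₂ cB T vh₂S mixFF j μ y ν y') := fun μ y ν y' =>
    ⟨_, _, _, _, SpineRooted.δwRecOf_pos hLc hr cE cVH cΛ cE₂ cB T hB hmix j, WrecAt_loc₂ hLc hr cE cVH cΛ cE₂ cB T hB hmix j μ y ν y'⟩
  have hA : ∀ (Y : Fin (d + 1) → ℤ) (κ : Fin (d + 1)) (u : Fin (d + 1) → ℤ),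
      cH' • ∑ v ∈ box (d + 1) Lc, divV (fun κ' u' => (cE₂ * wV4 d Lc (j + 1)) •
          e4OfKW Lc (coDressKBmAt (toSite r) Lc (KInvStep (d := d) Lc j)) (SpureRecAt d Lc (toSite r) cE cVH cΛ j) (M1At d Lc (toSite r) cΛ j)
            (WrecAt d Lc (toSite r) cE cVH cΛ cE₂ cB T vh₂S mixFF j) κ u κ' u') ((Lc : ℤ) • Y + toSite v) =
        comp ((cE * wE d Lc (j + 1)) • e3OfK Lc (coDressKBmAt (toSite r) Lc (KInvStep (d := d) Lc j)) (SrecAt d Lc (toSite r) cE cVH cΛ j) κ u)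
            (diagK (((1 : ℝ) / 2) • ∑ v ∈ box (d + 1) Lc, legInd (toSite r) ((Lc : ℤ) • Y + toSite v)))
          - comp (diagK (((1 : ℝ) / 2) • ∑ v ∈ box (d + 1) Lc, legInd (toSite r) ((Lc : ℤ) • Y + toSite v)))
            ((cE * wE d Lc (j + 1)) • e3OfK Lc (coDressKBmAt (toSite r) Lc (KInvStep (d := d) Lc j)) (SrecAt d Lc (toSite r) cE cVH cΛ j) κ u)
          + -(cH' * (cE₂ * wV4 d Lc (j + 1))) • ∑ v ∈ box (d + 1) Lc,
              mmRead Lc (comp (comp (coDressKBmAt (toSite r) Lc (KInvStep (d := d) Lc j)) (𝒩 ((Lc : ℤ) • Y + toSite v) κ u))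
                (coDressKBmAt (toSite r) Lc (KInvStep (d := d) Lc j))) := by
    intro Y κ u
    rw [← mmRead_K2OfK_eq_e3OfK _ κ u (dM_SpureRecAt_M1At hr cE cVH cΛ j κ u)]
    exact tableLaw_e4OfKW_sector'' hKs (spr_bhKStepAt hr j) (spr_axEc _ _) (relInv_coDressKBmAt_KInvStep_bhKStepAt hr j) hDl hWl
      (WrecAt_swap (toSite r) cE cVH cΛ cE₂ cB T vh₂S mixFF j) hr ((1 : ℝ) / 2)
      (fun y => KernelWardLevels.loc_diagK_smul_sum_legInd Lc (toSite r) _ y) (fun y => comp_axEc_diagK_comm _ _ _)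
      (divV_dM_SpureRecAt_M1At_pin hr cΛ j) h𝒩 hWd hlock Lc (toSite r) Y κ u
  have h := sectorLaw_add'' (N' := Lc) (S₂A := fun κ u κ' u' => (cE₂ * wV4 d Lc (j + 1)) •
      e4OfKW Lc (coDressKBmAt (toSite r) Lc (KInvStep (d := d) Lc j)) (SpureRecAt d Lc (toSite r) cE cVH cΛ j) (M1At d Lc (toSite r) cΛ j)
        (WrecAt d Lc (toSite r) cE cVH cΛ cE₂ cB T vh₂S mixFF j) κ u κ' u')
    (S₂B := fun κ u κ' u' => (cB * wB2 d Lc (j + 1)) • vh₂S κ u κ' u') hA hBord'' Y κ u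
  simpa only [T2RecAt_succ, SpureRecAt_succ] using h

/-! ## §4 Level 0: the Wilson letter + the border letter ⇒ the table laws of `T2RecAt 0` against `SpureRecAt 0` -/

/-- [folklore] **THE `hS₂` LAW OF THE LEVEL-0 FIELD TABLE `T2RecAt 0 = cE₂ • wilsonW₂ d T + cB • vh₂S`, FIRST SLOT**, against
`SpureRecAt 0 = Lc^{d+1} • wilsonA d + cVH • vhSAt ρ` (pin): from the WILSON letter `hWil` of the sector `cE₂ • wilsonW₂ d T` against `Lc^{d+1} • wilsonA d`
(remainder `RW`; for `T := wsym22 N` and `RW = 0` this is leaf-09-g4's `WilsonBiStencilWardSocket.hS₂_wilson` up to the factor `cE₂`) and the BORDER letter `hBord`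
of `cB • vh₂S` against `cVH • vhSAt ρ` (remainder `RB`).  Pure §1 bookkeeping. -/
theorem tableLaw_T2RecAt_zero {r : Fin (d + 1) → ℕ} (cΛ cE₂ cB : ℝ) (T : Fin 4 → Fin 4 → Fin 4 → Fin 4 → ℝ)
    (vh₂S mixFF : Fin (d + 1) → (Fin (d + 1) → ℤ) → Fin (d + 1) → (Fin (d + 1) → ℤ) → MKer (d + 1) (Fib d)) {cH' : ℝ}
    {RW RB : (Fin (d + 1) → ℤ) → Fin (d + 1) → (Fin (d + 1) → ℤ) → MKer (d + 1) (Fib d)}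
    (hWil : ∀ (Y : Fin (d + 1) → ℤ) (κ' : Fin (d + 1)) (u' : Fin (d + 1) → ℤ),
      cH' • ∑ v ∈ box (d + 1) Lc, divV (fun κ u => cE₂ • wilsonW₂ d T κ u κ' u') ((Lc : ℤ) • Y + toSite v) =
        comp (((Lc : ℝ) ^ (d + 1)) • wilsonA d κ' u') (diagK (((1 : ℝ) / 2) • ∑ v ∈ box (d + 1) Lc, legInd (toSite r) ((Lc : ℤ) • Y + toSite v)))
          - comp (diagK (((1 : ℝ) / 2) • ∑ v ∈ box (d + 1) Lc, legInd (toSite r) ((Lc : ℤ) • Y + toSite v))) (((Lc : ℝ) ^ (d + 1)) • wilsonA d κ' u')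
          + RW Y κ' u')
    (hBord : ∀ (Y : Fin (d + 1) → ℤ) (κ' : Fin (d + 1)) (u' : Fin (d + 1) → ℤ),
      cH' • ∑ v ∈ box (d + 1) Lc, divV (fun κ u => cB • vh₂S κ u κ' u') ((Lc : ℤ) • Y + toSite v) =
        comp ((-((Lc : ℝ) ^ (d + 1) * (1 / 2) * (Lc : ℝ) ^ (d + 1))) • vhSAt (toSite r) d Lc rfl κ' u')
            (diagK (((1 : ℝ) / 2) • ∑ v ∈ box (d + 1) Lc, legInd (toSite r) ((Lc : ℤ) • Y + toSite v)))
          - comp (diagK (((1 : ℝ) / 2) • ∑ v ∈ box (d + 1) Lc, legInd (toSite r) ((Lc : ℤ) • Y + toSite v)))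
            ((-((Lc : ℝ) ^ (d + 1) * (1 / 2) * (Lc : ℝ) ^ (d + 1))) • vhSAt (toSite r) d Lc rfl κ' u')
          + RB Y κ' u')
    (Y : Fin (d + 1) → ℤ) (κ' : Fin (d + 1)) (u' : Fin (d + 1) → ℤ) :
    cH' • ∑ v ∈ box (d + 1) Lc, divV (fun κ u =>
        T2RecAt d Lc (toSite r) ((Lc : ℝ) ^ (d + 1)) (-((Lc : ℝ) ^ (d + 1) * (1 / 2) * (Lc : ℝ) ^ (d + 1))) cΛ cE₂ cB T vh₂S mixFF 0 κ u κ' u')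
        ((Lc : ℤ) • Y + toSite v) =
      comp (SpureRecAt d Lc (toSite r) ((Lc : ℝ) ^ (d + 1)) (-((Lc : ℝ) ^ (d + 1) * (1 / 2) * (Lc : ℝ) ^ (d + 1))) cΛ 0 κ' u')
          (diagK (((1 : ℝ) / 2) • ∑ v ∈ box (d + 1) Lc, legInd (toSite r) ((Lc : ℤ) • Y + toSite v)))
        - comp (diagK (((1 : ℝ) / 2) • ∑ v ∈ box (d + 1) Lc, legInd (toSite r) ((Lc : ℤ) • Y + toSite v)))
          (SpureRecAt d Lc (toSite r) ((Lc : ℝ) ^ (d + 1)) (-((Lc : ℝ) ^ (d + 1) * (1 / 2) * (Lc : ℝ) ^ (d + 1))) cΛ 0 κ' u')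
        + (RW Y κ' u' + RB Y κ' u') := by
  have h := sectorLaw_add (N' := Lc) hWil hBord Y κ' u'
  simpa only [T2RecAt_zero_level, SpureRecAt_zero_level] using h

/-- [folklore] **THE `hS₂''` LAW OF THE LEVEL-0 FIELD TABLE, SECOND SLOT**, from the second-slot Wilson letter `hWil''` and border letter `hBord''`. -/
theorem tableLaw_T2RecAt_zero'' {r : Fin (d + 1) → ℕ} (cΛ cE₂ cB : ℝ) (T : Fin 4 → Fin 4 → Fin 4 → Fin 4 → ℝ)
    (vh₂S mixFF : Fin (d + 1) → (Fin (d + 1) → ℤ) → Fin (d + 1) → (Fin (d + 1) → ℤ) → MKer (d + 1) (Fib d)) {cH' : ℝ}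
    {RW'' RB'' : (Fin (d + 1) → ℤ) → Fin (d + 1) → (Fin (d + 1) → ℤ) → MKer (d + 1) (Fib d)}
    (hWil'' : ∀ (Y : Fin (d + 1) → ℤ) (κ : Fin (d + 1)) (u : Fin (d + 1) → ℤ),
      cH' • ∑ v ∈ box (d + 1) Lc, divV (fun κ' u' => cE₂ • wilsonW₂ d T κ u κ' u') ((Lc : ℤ) • Y + toSite v) =
        comp (((Lc : ℝ) ^ (d + 1)) • wilsonA d κ u) (diagK (((1 : ℝ) / 2) • ∑ v ∈ box (d + 1) Lc, legInd (toSite r) ((Lc : ℤ) • Y + toSite v)))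
          - comp (diagK (((1 : ℝ) / 2) • ∑ v ∈ box (d + 1) Lc, legInd (toSite r) ((Lc : ℤ) • Y + toSite v))) (((Lc : ℝ) ^ (d + 1)) • wilsonA d κ u)
          + RW'' Y κ u)
    (hBord'' : ∀ (Y : Fin (d + 1) → ℤ) (κ : Fin (d + 1)) (u : Fin (d + 1) → ℤ),
      cH' • ∑ v ∈ box (d + 1) Lc, divV (fun κ' u' => cB • vh₂S κ u κ' u') ((Lc : ℤ) • Y + toSite v) =
        comp ((-((Lc : ℝ) ^ (d + 1) * (1 / 2) * (Lc : ℝ) ^ (d + 1))) • vhSAt (toSite r) d Lc rfl κ u)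
            (diagK (((1 : ℝ) / 2) • ∑ v ∈ box (d + 1) Lc, legInd (toSite r) ((Lc : ℤ) • Y + toSite v)))
          - comp (diagK (((1 : ℝ) / 2) • ∑ v ∈ box (d + 1) Lc, legInd (toSite r) ((Lc : ℤ) • Y + toSite v)))
            ((-((Lc : ℝ) ^ (d + 1) * (1 / 2) * (Lc : ℝ) ^ (d + 1))) • vhSAt (toSite r) d Lc rfl κ u)
          + RB'' Y κ u)
    (Y : Fin (d + 1) → ℤ) (κ : Fin (d + 1)) (u : Fin (d + 1) → ℤ) :
    cH' • ∑ v ∈ box (d + 1) Lc, divV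
        (T2RecAt d Lc (toSite r) ((Lc : ℝ) ^ (d + 1)) (-((Lc : ℝ) ^ (d + 1) * (1 / 2) * (Lc : ℝ) ^ (d + 1))) cΛ cE₂ cB T vh₂S mixFF 0 κ u)
        ((Lc : ℤ) • Y + toSite v) =
      comp (SpureRecAt d Lc (toSite r) ((Lc : ℝ) ^ (d + 1)) (-((Lc : ℝ) ^ (d + 1) * (1 / 2) * (Lc : ℝ) ^ (d + 1))) cΛ 0 κ u)
          (diagK (((1 : ℝ) / 2) • ∑ v ∈ box (d + 1) Lc, legInd (toSite r) ((Lc : ℤ) • Y + toSite v)))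
        - comp (diagK (((1 : ℝ) / 2) • ∑ v ∈ box (d + 1) Lc, legInd (toSite r) ((Lc : ℤ) • Y + toSite v)))
          (SpureRecAt d Lc (toSite r) ((Lc : ℝ) ^ (d + 1)) (-((Lc : ℝ) ^ (d + 1) * (1 / 2) * (Lc : ℝ) ^ (d + 1))) cΛ 0 κ u)
        + (RW'' Y κ u + RB'' Y κ u) := by
  have h := sectorLaw_add'' (N' := Lc) (S₂A := fun κ u κ' u' => cE₂ • wilsonW₂ d T κ u κ' u')
    (S₂B := fun κ u κ' u' => cB • vh₂S κ u κ' u') hWil'' hBord'' Y κ u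
  simpa only [T2RecAt_zero_level, SpureRecAt_zero_level] using h

/-! ## §5 The lock at the Ward constant of `G_{j+1}` is `cE₂ = Lc^{2(d+1)}`, every level -/

omit [NeZero Lc] in
/-- [folklore] **THE LEVEL-(j+1) UNITS LOCK FROM THE PIN `cE₂ = Lc^{2(d+1)}`**: with the ℋ-column Ward constant `cH′ := (stepScale (j+1)·Lc^{d+1})⁻¹` of
`KernelWardHColumnWall.colH_ward_KInvStep_all` at level `j+1`, `wV4 = stepScale⁴`, `wE = stepScale³` give
`cH′·(cE₂·wV4 (j+1))·½ = (Lc^{d+1}·wE (j+1))·½` as soon as `cE₂ = Lc^{2(d+1)}` (an2's (W-L-2), gan24's `hpinEq`) — one pin, all levels. -/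
theorem lock_succ_of_pin (hLc : 1 ≤ Lc) {cE₂ : ℝ} (hcE₂ : cE₂ = (Lc : ℝ) ^ (2 * (d + 1))) (j : ℕ) :
    (stepScale d Lc (j + 1) * (Lc : ℝ) ^ (d + 1))⁻¹ * (cE₂ * wV4 d Lc (j + 1)) * ((1 : ℝ) / 2) =
      ((Lc : ℝ) ^ (d + 1) * wE d Lc (j + 1)) * ((1 : ℝ) / 2) := by
  have hL : (Lc : ℝ) ≠ 0 := Nat.cast_ne_zero.2 (by omega)
  have hs : stepScale d Lc (j + 1) ≠ 0 := by unfold stepScale; positivity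
  subst hcE₂
  unfold BalabanStepW2.wV4 BalabanStepJetsSucc.wE
  unfold BorderedHessian.stepScale at hs ⊢
  field_simp
  ring

end Wall

end Summit.QuantumFields.BalabanUV.Beta.WardLocusQuarticTable

end
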